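import Summits.AtomisticToContinuum.Crystallization.Theorems.IsometryAtomsMinimisingLawsCohesiveNoSlabsAux1
import Summits.AtomisticToContinuum.Crystallization.Theorems.PalmUnimodularRigidityMinimiserShellsEnergyFloor

/-!
# Minimising laws charge no slabs (stub `stub_noSlabs` of line `purity_stacking`, crux
# `IsometryAtoms.MinimisingLawsCohesive`, stmt-AtomisticToContinuum-15777), helper 2:
# the stacking map, the stacked hard-core configuration, the energy drop

Support file for the registered stub `stub_noSlabs`.  Contents (namespace
`…IsometryAtomsMinimisingLawsCohesive.NoSlabs`):

* the **stacking map** `T_v μ = Σ_{k ∈ ℤ} θ_{k v} μ = Measure.sum (fun k : ℤ => μ.map (· - k v))`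
  (the configuration together with all its translates by integer multiples of the period `v`):
  Giry-measurable (`measurable_stack`), commuting with re-rooting (`stack_map_sub`), `v`-periodic
  (`stack_map_sub_period`, `stack_map_sub_sub_period`), `∫ f d(T_v μ) = Σₖ ∫ f(y - k v) dμ`
  (`lintegral_stack`);
* on a counting measure `count|S` with no bad pair for `v` the stack is the counting measure of the
  DISJOINT union `⋃ₖ (S - k v)` (`stack_count_restrict`), a rooted `min δ 1`-hard-core
  configuration if `S ∋ 0` is `δ`-separated (`noSlabs_isRootedHardCore_stack`, the anchor;
  `isRootedHardCore_stack_of_mem`);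
* the **energy drop** `h'(T_v (count|S)) ≤ h'(count|S) + V_LJ(‖v‖)/2` for the measurable root
  energy `h' = rootEnergy'` (`rootEnergy'_stack_le`): the added points are at distance `≥ 1` from
  the root (`V_LJ ≤ 0` there) and the point `-v` contributes `V_LJ(‖v‖)`.
-/

noncomputable section

open MeasureTheory Set Filter Metric TopologicalSpace
open scoped ENNReal

namespace Summit.AtomisticToContinuum.Crystallization.Theorems.IsometryAtomsMinimisingLawsCohesive.NoSlabs

open Literature.Probability.Process
open Literature.MathematicalPhysics.StatisticalMechanics (lennardJones)
open Summit.AtomisticToContinuum.Crystallization.Theorems.MinimiserShells.Negative.Rootedness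
  (countable_of_separated)
open Summit.AtomisticToContinuum.Crystallization.Theorems.PalmUnimodularRigidityMinimiserShells.EnergyFloor
  (rootEnergy' lintegral_neg_le_of_hc)

/-! ## The stacking map

`T_v μ = Σ_{k ∈ ℤ} θ_{k v} μ = Measure.sum (fun k : ℤ => μ.map (· - k v))`: the configuration
stacked with all its translates by integer multiples of the period vector `v`. -/

/-- Evaluation of the stacked configuration at a measurable set. -/
theorem stack_apply (v : EuclideanSpace ℝ (Fin 3)) (μ : Measure (EuclideanSpace ℝ (Fin 3)))
    {s : Set (EuclideanSpace ℝ (Fin 3))} (hs : MeasurableSet s) :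
    Measure.sum (fun k : ℤ => μ.map (fun z => z - (k : ℝ) • v)) s =
      ∑' k : ℤ, μ ((fun z => z - (k : ℝ) • v) ⁻¹' s) := by
  rw [Measure.sum_apply _ hs]
  congr 1
  funext k
  rw [Measure.map_apply (measurable_sub_const _) hs]

/-- The stacking map is Giry-measurable. -/
theorem measurable_stack (v : EuclideanSpace ℝ (Fin 3)) :
    Measurable fun μ : Measure (EuclideanSpace ℝ (Fin 3)) =>
      Measure.sum (fun k : ℤ => μ.map (fun z => z - (k : ℝ) • v)) := by
  refine Measure.measurable_of_measurable_coe _ fun s hs => ?_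
  simp_rw [stack_apply v _ hs]
  exact Measurable.tsum fun k => Measure.measurable_coe ((measurable_sub_const _) hs)

/-- Stacking commutes with re-rooting (translations commute). -/
theorem stack_map_sub (v : EuclideanSpace ℝ (Fin 3)) (μ : Measure (EuclideanSpace ℝ (Fin 3)))
    (y : EuclideanSpace ℝ (Fin 3)) :
    Measure.sum (fun k : ℤ => (μ.map (fun z => z - y)).map (fun z => z - (k : ℝ) • v)) =
      (Measure.sum (fun k : ℤ => μ.map (fun z => z - (k : ℝ) • v))).map (fun z => z - y) := by
  rw [Measure.map_sum (measurable_sub_const y).aemeasurable]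
  congr 1
  funext k
  rw [Measure.map_map (measurable_sub_const _) (measurable_sub_const _),
    Measure.map_map (measurable_sub_const _) (measurable_sub_const _)]
  congr 1
  funext z
  simp only [Function.comp_apply]
  abel

/-- **Periodicity of the stacked configuration**: `θ_{m v} (T_v μ) = T_v μ` (reindex the sum). -/
theorem stack_map_sub_period (v : EuclideanSpace ℝ (Fin 3)) (μ : Measure (EuclideanSpace ℝ (Fin 3)))
    (m : ℤ) :
    (Measure.sum (fun k : ℤ => μ.map (fun z => z - (k : ℝ) • v))).map (fun z => z - (m : ℝ) • v) =
      Measure.sum (fun k : ℤ => μ.map (fun z => z - (k : ℝ) • v)) := by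
  rw [Measure.map_sum (measurable_sub_const _).aemeasurable]
  have h : (fun k : ℤ => (μ.map (fun z => z - (k : ℝ) • v)).map (fun z => z - (m : ℝ) • v)) =
      (fun k : ℤ => μ.map (fun z => z - (k : ℝ) • v)) ∘ (Equiv.addRight m) := by
    funext k
    simp only [Function.comp_apply, Equiv.coe_addRight]
    rw [Measure.map_map (measurable_sub_const _) (measurable_sub_const _)]
    congr 1
    funext z
    simp only [Function.comp_apply, Int.cast_add, add_smul]
    abel
  rw [h, Measure.sum_comp_equiv]

/-- Re-rooting the stacked configuration at `y - m v` is re-rooting it at `y`. -/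
theorem stack_map_sub_sub_period (v : EuclideanSpace ℝ (Fin 3)) (μ : Measure (EuclideanSpace ℝ (Fin 3)))
    (y : EuclideanSpace ℝ (Fin 3)) (m : ℤ) :
    (Measure.sum (fun k : ℤ => μ.map (fun z => z - (k : ℝ) • v))).map
        (fun z => z - (y - (m : ℝ) • v)) =
      (Measure.sum (fun k : ℤ => μ.map (fun z => z - (k : ℝ) • v))).map (fun z => z - y) := by
  have h : (fun z : EuclideanSpace ℝ (Fin 3) => z - (y - (m : ℝ) • v)) =
      (fun z => z - y) ∘ (fun z => z - ((-m : ℤ) : ℝ) • v) := by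
    funext z
    simp only [Function.comp_apply, Int.cast_neg, neg_smul]
    abel
  rw [h, ← Measure.map_map (measurable_sub_const _) (measurable_sub_const _), stack_map_sub_period]

/-- Integration against the stacked configuration. -/
theorem lintegral_stack (v : EuclideanSpace ℝ (Fin 3)) (μ : Measure (EuclideanSpace ℝ (Fin 3)))
    (f : EuclideanSpace ℝ (Fin 3) → ℝ≥0∞) :
    ∫⁻ z, f z ∂(Measure.sum (fun k : ℤ => μ.map (fun z => z - (k : ℝ) • v))) =
      ∑' k : ℤ, ∫⁻ y, f (y - (k : ℝ) • v) ∂μ := by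
  rw [lintegral_sum_measure]
  congr 1
  funext k
  exact (measurableEmbedding_subRight _).lintegral_map f

/-- **Stacking a counting measure with no bad pair** gives the counting measure of the disjoint
union of the translates `S - k v`, `k ∈ ℤ`. -/
theorem stack_count_restrict {S : Set (EuclideanSpace ℝ (Fin 3))} (hS : S.Countable)
    (v : EuclideanSpace ℝ (Fin 3))
    (hnb : ∀ s ∈ S, ∀ s' ∈ S, ∀ k : ℤ, k ≠ 0 → 1 ≤ ‖s - s' - (k : ℝ) • v‖) :
    Measure.sum (fun k : ℤ => (((Measure.count : Measure (EuclideanSpace ℝ (Fin 3))).restrict S).map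
        (fun z => z - (k : ℝ) • v))) =
      (Measure.count : Measure (EuclideanSpace ℝ (Fin 3))).restrict
        (⋃ k : ℤ, (fun z => z - (k : ℝ) • v) '' S) := by
  have hdisj : Pairwise (Function.onFun Disjoint fun k : ℤ =>
      (fun z : EuclideanSpace ℝ (Fin 3) => z - (k : ℝ) • v) '' S) := by
    intro k l hkl
    refine Set.disjoint_left.2 ?_
    rintro _ ⟨s, hs, rfl⟩ ⟨s', hs', he⟩
    have h1 := hnb s hs s' hs' (k - l) (sub_ne_zero.2 hkl)
    have h2 : s - s' - ((k - l : ℤ) : ℝ) • v = (s - (k : ℝ) • v) - (s' - (l : ℝ) • v) := by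
      push_cast
      rw [sub_smul]
      abel
    have he' : s' - (l : ℝ) • v = s - (k : ℝ) • v := he
    rw [h2, ← he', sub_self, norm_zero] at h1
    exact absurd h1 (by norm_num)
  simp_rw [map_sub_count_restrict]
  exact (Measure.restrict_iUnion hdisj fun k => (hS.image _).measurableSet).symm

/-- **The stacked configuration is a rooted hard-core configuration**: for `S ∋ 0` `δ`-separated
with no bad pair for `v`, the stacked set `⋃ₖ (S - k v)` contains `0` and is `min δ 1`-separated
(inside a translate: `δ`; across translates: `≥ 1` by "no bad pair"). -/
theorem noSlabs_isRootedHardCore_stack : ∀ δ : ℝ, 0 < δ → ∀ S : Set (EuclideanSpace ℝ (Fin 3)),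
    (0 : EuclideanSpace ℝ (Fin 3)) ∈ S → (∀ x ∈ S, ∀ y ∈ S, x ≠ y → δ ≤ dist x y) →
    ∀ v : EuclideanSpace ℝ (Fin 3), (∀ s ∈ S, ∀ s' ∈ S, ∀ k : ℤ, k ≠ 0 → 1 ≤ ‖s - s' - (k : ℝ) • v‖) →
    Literature.Probability.Process.IsRootedHardCore (min δ 1) (MeasureTheory.Measure.sum (fun k : ℤ =>
    ((MeasureTheory.Measure.count : MeasureTheory.Measure (EuclideanSpace ℝ (Fin 3))).restrict S).map
    (fun z => z - (k : ℝ) • v))) := by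
  intro δ hδ S h0 hsep v hnb
  rw [stack_count_restrict (countable_of_separated hδ hsep) v hnb]
  refine ⟨_, ?_, ?_, rfl⟩
  · exact Set.mem_iUnion.2 ⟨0, 0, h0, by simp⟩
  · intro x hx y hy hxy
    obtain ⟨k, hx⟩ := Set.mem_iUnion.1 hx
    obtain ⟨s, hs, rfl⟩ := hx
    obtain ⟨l, hy⟩ := Set.mem_iUnion.1 hy
    obtain ⟨s', hs', rfl⟩ := hy
    by_cases hkl : k = l
    · subst hkl
      have hss' : s ≠ s' := fun h => hxy (by rw [h])
      rw [dist_sub_right]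
      exact (min_le_left _ _).trans (hsep s hs s' hs' hss')
    · rw [dist_eq_norm]
      have h2 : s - (k : ℝ) • v - (s' - (l : ℝ) • v) = s - s' - ((k - l : ℤ) : ℝ) • v := by
        push_cast
        rw [sub_smul]
        abel
      rw [h2]
      exact (min_le_right _ _).trans (hnb s hs s' hs' (k - l) (sub_ne_zero.2 hkl))

/-- The stacked configuration of a rooted `δ`-hard-core configuration in the stacking event of `v`
is a rooted `min δ 1`-hard-core configuration. -/
theorem isRootedHardCore_stack_of_mem {δ : ℝ} (hδ : 0 < δ) {μ : Measure (EuclideanSpace ℝ (Fin 3))}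
    (hμ : IsRootedHardCore δ μ) (v : EuclideanSpace ℝ (Fin 3))
    (hmem : μ ∈ {μ : Measure (EuclideanSpace ℝ (Fin 3)) | ∀ k : ℤ, k ≠ 0 → ∀ n a : ℕ,
      μ (Metric.ball (TopologicalSpace.denseSeq (EuclideanSpace ℝ (Fin 3)) n) (1 / ((a : ℝ) + 1))) = 0 ∨
      μ (Metric.ball (TopologicalSpace.denseSeq (EuclideanSpace ℝ (Fin 3)) n - (k : ℝ) • v)
        (1 - 1 / ((a : ℝ) + 1))) = 0}) :
    IsRootedHardCore (min δ 1) (Measure.sum (fun k : ℤ => μ.map (fun z => z - (k : ℝ) • v))) := by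
  obtain ⟨S, h0, hsep, rfl⟩ := hμ
  exact noSlabs_isRootedHardCore_stack δ hδ S h0 hsep v ((count_restrict_mem_stackEvent_iff S v).1 hmem)

/-! ## The energy drop

Stacking does not change the positive part of the root's Lennard-Jones sum (the added points are at
distance `≥ 1` from the root, where `V_LJ ≤ 0`) and adds at least the term `-V_LJ(‖v‖) ≥ 0` of the
point `-v` to its negative part: `h'(T_v μ) ≤ h'(μ) + V_LJ(‖v‖)/2`. -/

/-- **Energy drop under stacking** (measurable root energy `rootEnergy'`): for `S ∋ 0`
`δ`-separated with no bad pair for `v`, `h'(T_v (count|S)) ≤ h'(count|S) + V_LJ(‖v‖) / 2`. -/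
theorem rootEnergy'_stack_le {δ : ℝ} (hδ : 0 < δ) {S : Set (EuclideanSpace ℝ (Fin 3))}
    (h0 : (0 : EuclideanSpace ℝ (Fin 3)) ∈ S) (hsep : ∀ x ∈ S, ∀ y ∈ S, x ≠ y → δ ≤ dist x y)
    (v : EuclideanSpace ℝ (Fin 3))
    (hnb : ∀ s ∈ S, ∀ s' ∈ S, ∀ k : ℤ, k ≠ 0 → 1 ≤ ‖s - s' - (k : ℝ) • v‖) :
    rootEnergy' (Measure.sum (fun k : ℤ =>
      (((Measure.count : Measure (EuclideanSpace ℝ (Fin 3))).restrict S).map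
        (fun z => z - (k : ℝ) • v)))) ≤
      rootEnergy' ((Measure.count : Measure (EuclideanSpace ℝ (Fin 3))).restrict S) +
        lennardJones ‖v‖ / 2 := by
  have hSm : MeasurableSet S := (countable_of_separated hδ hsep).measurableSet
  set μ := (Measure.count : Measure (EuclideanSpace ℝ (Fin 3))).restrict S with hμ
  have hhc : IsRootedHardCore δ μ := ⟨S, h0, hsep, rfl⟩
  have hhc' := noSlabs_isRootedHardCore_stack δ hδ S h0 hsep v hnb
  have hδ' : 0 < min δ 1 := lt_min hδ one_pos
  have hVv : 0 ≤ -lennardJones ‖v‖ := by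
    have h1 := hnb 0 h0 0 h0 1 one_ne_zero
    simp only [sub_self, Int.cast_one, one_smul, zero_sub, norm_neg] at h1
    linarith [Literature.MathematicalPhysics.StatisticalMechanics.lennardJones_nonpos h1]
  -- positive parts agree
  have hpos : ∫⁻ z, ENNReal.ofReal (lennardJones ‖z‖) ∂(Measure.sum (fun k : ℤ =>
        μ.map (fun z => z - (k : ℝ) • v))) = ∫⁻ y, ENNReal.ofReal (lennardJones ‖y‖) ∂μ := by
    rw [lintegral_stack, tsum_eq_single 0]
    · simp
    · intro k hk
      refine (lintegral_congr_ae ((ae_restrict_iff' hSm).2 (Eventually.of_forall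
        fun y hy => ?_))).trans lintegral_zero
      have h1 : 1 ≤ ‖y - (k : ℝ) • v‖ := by simpa using hnb y hy 0 h0 k hk
      exact ENNReal.ofReal_eq_zero.2
        (Literature.MathematicalPhysics.StatisticalMechanics.lennardJones_nonpos h1)
  -- the negative part grows by at least `-V(‖v‖)`
  have hneg : ∫⁻ y, ENNReal.ofReal (-lennardJones ‖y‖) ∂μ + ENNReal.ofReal (-lennardJones ‖v‖) ≤
      ∫⁻ z, ENNReal.ofReal (-lennardJones ‖z‖) ∂(Measure.sum (fun k : ℤ =>
        μ.map (fun z => z - (k : ℝ) • v))) := by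
    rw [lintegral_stack]
    calc ∫⁻ y, ENNReal.ofReal (-lennardJones ‖y‖) ∂μ + ENNReal.ofReal (-lennardJones ‖v‖)
        ≤ ∑ k ∈ ({0, 1} : Finset ℤ), ∫⁻ y, ENNReal.ofReal (-lennardJones ‖y - (k : ℝ) • v‖) ∂μ := by
          rw [Finset.sum_pair (by norm_num : (0 : ℤ) ≠ 1)]
          simp only [Int.cast_zero, zero_smul, sub_zero, Int.cast_one, one_smul]
          gcongr
          calc ENNReal.ofReal (-lennardJones ‖v‖)
              = ENNReal.ofReal (-lennardJones ‖(0 : EuclideanSpace ℝ (Fin 3)) - v‖) * μ {0} := by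
                rw [zero_sub, norm_neg, hhc.measure_zero_singleton, mul_one]
            _ = ∫⁻ y in {(0 : EuclideanSpace ℝ (Fin 3))}, ENNReal.ofReal (-lennardJones ‖y - v‖) ∂μ :=
                (lintegral_singleton (fun y : EuclideanSpace ℝ (Fin 3) =>
                  ENNReal.ofReal (-lennardJones ‖y - v‖)) (0 : EuclideanSpace ℝ (Fin 3))).symm
            _ ≤ ∫⁻ y, ENNReal.ofReal (-lennardJones ‖y - v‖) ∂μ := setLIntegral_le_lintegral _ _
      _ ≤ ∑' k : ℤ, ∫⁻ y, ENNReal.ofReal (-lennardJones ‖y - (k : ℝ) • v‖) ∂μ := ENNReal.sum_le_tsum _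
  -- finiteness of the pieces
  have hfin' : ∫⁻ z, ENNReal.ofReal (-lennardJones ‖z‖) ∂(Measure.sum (fun k : ℤ =>
      μ.map (fun z => z - (k : ℝ) • v))) ≠ ⊤ :=
    ((lintegral_neg_le_of_hc hδ' hhc').trans_lt ENNReal.ofReal_lt_top).ne
  have hfin : ∫⁻ y, ENNReal.ofReal (-lennardJones ‖y‖) ∂μ ≠ ⊤ :=
    ((lintegral_neg_le_of_hc hδ hhc).trans_lt ENNReal.ofReal_lt_top).ne
  have h1 : (∫⁻ y, ENNReal.ofReal (-lennardJones ‖y‖) ∂μ).toReal + (-lennardJones ‖v‖) ≤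
      (∫⁻ z, ENNReal.ofReal (-lennardJones ‖z‖) ∂(Measure.sum (fun k : ℤ =>
        μ.map (fun z => z - (k : ℝ) • v)))).toReal := by
    have := ENNReal.toReal_mono hfin' hneg
    rwa [ENNReal.toReal_add hfin ENNReal.ofReal_ne_top, ENNReal.toReal_ofReal hVv] at this
  unfold rootEnergy'
  rw [hpos]
  linarith

end Summit.AtomisticToContinuum.Crystallization.Theorems.IsometryAtomsMinimisingLawsCohesive.NoSlabs

end
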